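import Literature.NumberTheory.Sieve.GallagherSingularSeries
import Literature.NumberTheory.Sieve.GoldstonPintzYildirim
import Mathlib.Analysis.SpecialFunctions.Exponential
import HarnessLib

/-!
# Gallagher 1976, Theorem 1: uniform prime `r`-tuple asymptotics ⇒ Poisson distribution of
# the number of primes in intervals `(n, n + h]`, `h ∼ λ log N`

P. X. Gallagher, *On the distribution of primes in short intervals*, Mathematika **23** (1976), 4–9
(held `paper:doi-10-1112-s0025579300016442`, pp. 4–6 read 2026-08-28).

**Theorem 1** (p. 4). "Denote by `P_k(h, N)` the number of integers `n ≤ N` for which the interval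
`(n, n + h]` contains exactly `k` primes. Then `P_k(h, N) ∼ N e^{-λ} λ^k / k!` for `N → ∞`,
`h ∼ λ log N`, provided, for each `r`, (1) [`π_d(N) ∼ 𝔖_d N / logʳ N`] holds, uniformly for
`1 ≤ d₁, …, d_r ≤ h`, with `d₁, …, d_r` distinct and `𝔖_d ≠ 0`."

Gallagher's proof (§1 "Reduction to (3)", p. 5): the `k`-th moment of `π(n+h) − π(n)` over `n ≤ N`
is a Stirling-weighted sum of the tuple counts `π_d(N)` over `r`-tuples `d` in the cube `[1, h]^r`;
(1) and the singular-series average (3) `∑_{d distinct} 𝔖_d ∼ hʳ` (the tree theorem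
`Gallagher.tendsto_sum_singularSeries_div_pow`, file `GallagherSingularSeries.lean`) give moments
`→ m_k(λ)`, the Poisson moments, "and the Poisson distribution is determined by its moments" (§3).

This file PROVES Theorem 1 with one deviation, flagged: instead of ordinary moments + Stirling numbers
+ moment-determinacy (§3 of the paper) we use FACTORIAL moments — `∑_{n ≤ N} (π(n+h)−π(n))^{(r)}`
is literally the sum of `π_d(N)` over ORDERED distinct `r`-tuples, no Stirling numbers — and the
finite Bonferroni–Jordan truncation inequalities (`jordanSum` below: the partial sums
`∑_{j ≤ m} (−1)^j C(k+j, k) C(c, k+j)` alternate around `𝟙[c = k]`), which turn "factorial moments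
`→ λʳ`" into "`P_k/N → e^{−λ} λᵏ/k!`" by a squeeze, with no appeal to moment-determinacy.  This is
a genuinely shorter road in Lean (everything is a finite identity) and proves the printed statement.

Main results (namespace `Literature.NumberTheory.Sieve.Gallagher`):
* §1 `tendsto_density_eq_of_factorialMoments` — the moment method: if for every `r` the averaged
  `r`-th factorial moment of `f_N : ℕ → ℕ` over `n ∈ [1, N]` tends to `λʳ`, then
  `#{n ≤ N : f_N(n) = k}/N → e^{−λ} λᵏ/k!` [folklore; replaces Gallagher §3];
* §2 `windowCount n h = π(n+h) − π(n)`, `orderedTupleCount t N = π_t(N)` (Gallagher's `π_d(N)`,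
  ordered distinct shifts `t : Fin r → ℕ`), `exactCount k h N = P_k(h, N)`, and the counting
  identity `sum_descFactorial_windowCount` : `∑_{n ≤ N} (π(n+h)−π(n))^{(r)} = ∑_{t} π_t(N)`
  [cite: Gallagher1976, Section 1 p. 5];
* §3 `Gallagher1976_theorem1_of_moments` — Theorem 1 from the averaged input
  `∑_t π_t(N) / N → λʳ` (all `r`), for any `h = h(N)`; and `Gallagher1976_theorem1` — Theorem 1
  from the UNIFORM tuple asymptotics (absolute-error count form `GallagherUniformTuples`, the form
  that the generalised Hardy–Littlewood conjecture delivers) and `h(N)/log N → λ`, via the tree's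
  PROVED singular-series average [cite: Gallagher1976, Theorem 1].
-/

noncomputable section

open Filter Finset Real
open scoped Topology

namespace Literature.NumberTheory.Sieve.Gallagher

/-! ### §1 The factorial-moment method for the Poisson law (finite Bonferroni–Jordan squeeze) -/

/-- The Bonferroni–Jordan truncation `J_{k,m}(c) = ∑_{j=0}^{m} (−1)^j C(k+j, k) C(c, k+j)`: the
`m`-th partial sum of the inclusion–exclusion formula for `𝟙[c = k]` in terms of the binomial
moments `C(c, ·)`. [folklore] -/
def jordanSum (k m c : ℕ) : ℝ :=
  ∑ j ∈ range (m + 1), (-1 : ℝ) ^ j * ((k + j).choose k : ℝ) * (c.choose (k + j) : ℝ)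

/-- Closed form: `J_{k,m}(c) = 𝟙[c = k] + 𝟙[c > k] (−1)^m C(c,k) C(c−k−1, m)`
(from `C(c,k+j) C(k+j,k) = C(c,k) C(c−k,j)` and `∑_{j≤m} (−1)^j C(n+1,j) = (−1)^m C(n,m)`).
[folklore] -/
private theorem jordanSum_eq (k m c : ℕ) :
    jordanSum k m c = (if c = k then 1 else 0) +
      (if k < c then (-1 : ℝ) ^ m * (c.choose k : ℝ) * ((c - k - 1).choose m : ℝ) else 0) := by
  unfold jordanSum
  rcases lt_trichotomy c k with hlt | rfl | hgt
  · -- `c < k`: every term vanishes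
    rw [if_neg hlt.ne, if_neg (not_lt.2 hlt.le), add_zero]
    refine sum_eq_zero fun j _ => ?_
    rw [Nat.choose_eq_zero_of_lt (by omega : c < k + j)]
    simp
  · -- `c = k`: only `j = 0` survives
    rw [if_pos rfl, if_neg (lt_irrefl _), add_zero, sum_range_succ', ]
    have : ∀ j ∈ range m, (-1 : ℝ) ^ (j + 1) * ((c + (j + 1)).choose c : ℝ) *
        (c.choose (c + (j + 1)) : ℝ) = 0 := fun j _ => by
      rw [Nat.choose_eq_zero_of_lt (by omega : c < c + (j + 1))]; simp
    rw [sum_eq_zero this]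
    simp
  · -- `c > k`
    rw [if_neg hgt.ne', if_pos hgt, zero_add]
    have hterm : ∀ j ∈ range (m + 1), (-1 : ℝ) ^ j * ((k + j).choose k : ℝ) * (c.choose (k + j) : ℝ)
        = (c.choose k : ℝ) * ((-1 : ℝ) ^ j * ((c - k).choose j : ℝ)) := by
      intro j _
      have h := Nat.choose_mul (n := c) (k := k + j) (s := k) (Nat.le_add_right k j)
      -- `c.choose (k+j) * (k+j).choose k = c.choose k * (c-k).choose j`
      rw [Nat.add_sub_cancel_left] at h
      have h' : ((c.choose (k + j) : ℝ)) * ((k + j).choose k : ℝ) =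
          (c.choose k : ℝ) * ((c - k).choose j : ℝ) := by exact_mod_cast h
      calc (-1 : ℝ) ^ j * ((k + j).choose k : ℝ) * (c.choose (k + j) : ℝ)
          = (-1 : ℝ) ^ j * ((c.choose (k + j) : ℝ) * ((k + j).choose k : ℝ)) := by ring
        _ = (c.choose k : ℝ) * ((-1 : ℝ) ^ j * ((c - k).choose j : ℝ)) := by rw [h']; ring
    rw [sum_congr rfl hterm, ← mul_sum]
    obtain ⟨n, hn⟩ : ∃ n, c - k = n + 1 := ⟨c - k - 1, by omega⟩
    have halt := Int.alternating_sum_range_choose_eq_choose (n := n) (m := m)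
    have halt' : (∑ j ∈ range (m + 1), (-1 : ℝ) ^ j * ((n + 1).choose j : ℝ)) =
        (-1 : ℝ) ^ m * (n.choose m : ℝ) := by exact_mod_cast halt
    rw [hn, halt', Nat.add_sub_cancel]
    ring

/-- For even `m`, the truncation over-counts: `𝟙[c = k] ≤ J_{k,m}(c)`. [folklore] -/
private theorem indicator_le_jordanSum {m : ℕ} (hm : Even m) (k c : ℕ) :
    (if c = k then (1 : ℝ) else 0) ≤ jordanSum k m c := by
  rw [jordanSum_eq, hm.neg_one_pow]
  have h0 : 0 ≤ (c.choose k : ℝ) * ((c - k - 1).choose m : ℝ) := by positivity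
  split_ifs <;> linarith

/-- For odd `m`, the truncation under-counts: `J_{k,m}(c) ≤ 𝟙[c = k]`. [folklore] -/
private theorem jordanSum_le_indicator {m : ℕ} (hm : Odd m) (k c : ℕ) :
    jordanSum k m c ≤ (if c = k then (1 : ℝ) else 0) := by
  rw [jordanSum_eq, hm.neg_one_pow]
  have h0 : 0 ≤ (c.choose k : ℝ) * ((c - k - 1).choose m : ℝ) := by positivity
  split_ifs <;> first | omega | linarith

/-- Partial sums of the exponential series at `−λ` tend to `e^{−λ}`. [folklore] -/
private theorem tendsto_expPartial (x : ℝ) :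
    Tendsto (fun m : ℕ => ∑ j ∈ range m, x ^ j / (j.factorial : ℝ)) atTop (𝓝 (Real.exp x)) := by
  have h := NormedSpace.expSeries_div_hasSum_exp (𝔸 := ℝ) x
  rw [← congrFun Real.exp_eq_exp_ℝ x] at h
  exact h.tendsto_sum_nat

/-- **The factorial-moment method (Poisson case).**  Let `f_N : ℕ → ℕ` (`N ∈ ℕ`) and `λ ∈ ℝ`.  If
for every `r` the averaged factorial moment `N⁻¹ ∑_{n=1}^{N} f_N(n)^{(r)}` tends to `λʳ`, then for
every `k` the density `N⁻¹ #{1 ≤ n ≤ N : f_N(n) = k}` tends to `e^{−λ} λᵏ/k!`.  Proof: sum the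
Bonferroni–Jordan inequalities over `n`, pass to the limit for fixed `m` (a finite combination of
moments, `→ (λᵏ/k!) ∑_{j ≤ m} (−λ)^j/j!`), then let `m → ∞` along even / odd `m`.  This is the
role of Gallagher's §3 ("`m_k(λ)` is the `k`th moment of the Poisson distribution … it follows that
`P_k(h,N) ∼ N e^{−λ} λᵏ/k!`"), in factorial-moment form. [cite: Gallagher1976, Section 3] -/
theorem tendsto_density_eq_of_factorialMoments {f : ℕ → ℕ → ℕ} {lam : ℝ}
    (hmom : ∀ r : ℕ, Tendsto (fun N : ℕ =>
      (∑ n ∈ Icc 1 N, ((f N n).descFactorial r : ℝ)) / N) atTop (𝓝 (lam ^ r)))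
    (k : ℕ) :
    Tendsto (fun N : ℕ => (#{n ∈ Icc 1 N | f N n = k} : ℝ) / N) atTop
      (𝓝 (Real.exp (-lam) * lam ^ k / k.factorial)) := by
  -- binomial moments
  have hbin : ∀ r : ℕ, Tendsto (fun N : ℕ =>
      (∑ n ∈ Icc 1 N, ((f N n).choose r : ℝ)) / N) atTop (𝓝 (lam ^ r / r.factorial)) := by
    intro r
    have hr : (0 : ℝ) < r.factorial := by exact_mod_cast r.factorial_pos
    have hsum : ∀ N : ℕ, (∑ n ∈ Icc 1 N, ((f N n).choose r : ℝ)) =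
        (∑ n ∈ Icc 1 N, ((f N n).descFactorial r : ℝ)) / r.factorial := by
      intro N
      rw [eq_div_iff hr.ne', sum_mul]
      refine sum_congr rfl fun n _ => ?_
      rw [Nat.descFactorial_eq_factorial_mul_choose]
      push_cast
      ring
    refine ((hmom r).div_const (r.factorial : ℝ)).congr fun N => ?_
    rw [hsum N, div_right_comm]
  -- the limit of the averaged Jordan sums, for fixed `m`
  set e : ℕ → ℝ := fun m => ∑ j ∈ range (m + 1), (-lam) ^ j / (j.factorial : ℝ) with he
  have hJ : ∀ m : ℕ, Tendsto (fun N : ℕ => (∑ n ∈ Icc 1 N, jordanSum k m (f N n)) / N) atTop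
      (𝓝 (lam ^ k / k.factorial * e m)) := by
    intro m
    have hrw : (fun N : ℕ => (∑ n ∈ Icc 1 N, jordanSum k m (f N n)) / N) = fun N : ℕ =>
        ∑ j ∈ range (m + 1), (-1 : ℝ) ^ j * ((k + j).choose k : ℝ) *
          ((∑ n ∈ Icc 1 N, ((f N n).choose (k + j) : ℝ)) / N) := by
      funext N
      simp only [jordanSum]
      rw [sum_comm, sum_div]
      refine sum_congr rfl fun j _ => ?_
      rw [← mul_sum, mul_div_assoc]
    rw [hrw]
    have hlim : Tendsto (fun N : ℕ => ∑ j ∈ range (m + 1), (-1 : ℝ) ^ j * ((k + j).choose k : ℝ) *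
        ((∑ n ∈ Icc 1 N, ((f N n).choose (k + j) : ℝ)) / N)) atTop
        (𝓝 (∑ j ∈ range (m + 1), (-1 : ℝ) ^ j * ((k + j).choose k : ℝ) *
          (lam ^ (k + j) / (k + j).factorial))) :=
      tendsto_finsetSum _ fun j _ => (hbin (k + j)).const_mul _
    convert hlim using 2
    rw [he, mul_sum]
    refine sum_congr rfl fun j _ => ?_
    have hk : (0 : ℝ) < k.factorial := by exact_mod_cast k.factorial_pos
    have hj : (0 : ℝ) < j.factorial := by exact_mod_cast j.factorial_pos
    have hc' : ((k + j).choose k : ℝ) * k.factorial * j.factorial = (k + j).factorial := by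
      have h := Nat.choose_mul_factorial_mul_factorial (Nat.le_add_right k j)
      rw [Nat.add_sub_cancel_left] at h
      exact_mod_cast h
    have hc : ((k + j).choose k : ℝ) ≠ 0 := by
      exact_mod_cast (Nat.choose_pos (Nat.le_add_right k j)).ne'
    rw [neg_pow, pow_add, ← hc']
    field_simp
  -- `e m → exp(-λ)`
  have he_lim : Tendsto (fun m => lam ^ k / k.factorial * e m) atTop
      (𝓝 (Real.exp (-lam) * lam ^ k / k.factorial)) := by
    have h1 : Tendsto e atTop (𝓝 (Real.exp (-lam))) := by
      rw [he]
      exact (tendsto_expPartial (-lam)).comp (tendsto_add_atTop_nat 1)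
    have := h1.const_mul (lam ^ k / k.factorial)
    convert this using 2
    ring
  -- the squeeze
  set L := Real.exp (-lam) * lam ^ k / k.factorial with hL
  rw [tendsto_order]
  constructor
  · intro b hb
    -- lower bound via odd `m`
    obtain ⟨M, hM⟩ := (tendsto_order.1 he_lim).1 b hb |>.exists_forall_of_atTop
    set m := 2 * M + 1 with hm
    have hmo : Odd m := ⟨M, by omega⟩
    have hbm : b < lam ^ k / k.factorial * e m := hM m (by omega)
    have hev := (tendsto_order.1 (hJ m)).1 b hbm
    filter_upwards [hev, eventually_gt_atTop 0] with N hN hN0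
    refine lt_of_lt_of_le hN ?_
    have hNpos : (0 : ℝ) < N := by exact_mod_cast hN0
    rw [div_le_div_iff_of_pos_right hNpos]
    calc ∑ n ∈ Icc 1 N, jordanSum k m (f N n)
        ≤ ∑ n ∈ Icc 1 N, (if f N n = k then (1 : ℝ) else 0) :=
          sum_le_sum fun n _ => jordanSum_le_indicator hmo k (f N n)
      _ = (#{n ∈ Icc 1 N | f N n = k} : ℝ) := by
          rw [← sum_boole]
  · intro b hb
    -- upper bound via even `m`
    obtain ⟨M, hM⟩ := (tendsto_order.1 he_lim).2 b hb |>.exists_forall_of_atTop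
    set m := 2 * M with hm
    have hme : Even m := ⟨M, by omega⟩
    have hbm : lam ^ k / k.factorial * e m < b := hM m (by omega)
    have hev := (tendsto_order.1 (hJ m)).2 b hbm
    filter_upwards [hev, eventually_gt_atTop 0] with N hN hN0
    refine lt_of_le_of_lt ?_ hN
    have hNpos : (0 : ℝ) < N := by exact_mod_cast hN0
    rw [div_le_div_iff_of_pos_right hNpos]
    calc (#{n ∈ Icc 1 N | f N n = k} : ℝ)
        = ∑ n ∈ Icc 1 N, (if f N n = k then (1 : ℝ) else 0) := by rw [← sum_boole]
      _ ≤ ∑ n ∈ Icc 1 N, jordanSum k m (f N n) :=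
          sum_le_sum fun n _ => indicator_le_jordanSum hme k (f N n)

/-! ### §2 Primes in the window `(n, n+h]`, tuple counts, and Gallagher's counting identity -/

/-- `π(n + h) − π(n)`: the number of primes in the interval `(n, n + h]`.
[cite: Gallagher1976, Theorem 1] -/
def windowCount (n h : ℕ) : ℕ := #((Ioc n (n + h)).filter Nat.Prime)

/-- Gallagher's `P_k(h, N)`: the number of integers `1 ≤ n ≤ N` for which `(n, n + h]` contains
exactly `k` primes. [cite: Gallagher1976, Theorem 1] -/
def exactCount (k h N : ℕ) : ℕ := #((Icc 1 N).filter fun n => windowCount n h = k)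

/-- Gallagher's `π_d(N)` for an ORDERED tuple of shifts `t = (d₁, …, d_r)`: the number of
`1 ≤ n ≤ N` with `n + d₁, …, n + d_r` all prime. [cite: Gallagher1976, eq. 1] -/
def orderedTupleCount {r : ℕ} (t : Fin r → ℕ) (N : ℕ) : ℕ :=
  #((Icc 1 N).filter fun n => ∀ j, (n + t j).Prime)

open Literature.NumberTheory.Sieve.GPY (distinctTuples mem_distinctTuples card_distinctTuples_le)

/-- The number of injective maps `Fin r → X` into a finset is the falling factorial
`(#X)^{(r)} = #X (#X − 1) ⋯ (#X − r + 1)`. [folklore] -/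
private theorem card_filter_piFinset_injective {α : Type*} [DecidableEq α] (X : Finset α) (r : ℕ) :
    #((Fintype.piFinset fun _ : Fin r => X).filter Function.Injective) = (#X).descFactorial r := by
  classical
  set S := (Fintype.piFinset fun _ : Fin r => X).filter Function.Injective with hS
  have e : S ≃ (Fin r ↪ X) :=
    { toFun := fun t => ⟨fun j => ⟨t.1 j, Fintype.mem_piFinset.1 (mem_filter.1 t.2).1 j⟩,
        fun a b hab => (mem_filter.1 t.2).2 (congrArg Subtype.val hab)⟩
      invFun := fun e => ⟨fun j => (e j).1, mem_filter.2 ⟨Fintype.mem_piFinset.2 fun j => (e j).2,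
        fun a b hab => e.injective (Subtype.ext hab)⟩⟩
      left_inv := fun t => by ext; rfl
      right_inv := fun e => by ext; rfl }
  rw [← Fintype.card_coe S, Fintype.card_congr e, Fintype.card_embedding_eq, Fintype.card_coe,
    Fintype.card_fin]

/-- The shifts `d ∈ [1, h]` with `n + d` prime are in bijection with the primes of `(n, n + h]`, so
there are `π(n+h) − π(n)` of them. [folklore] -/
private theorem card_filter_shift_prime (n h : ℕ) :
    #((Icc 1 h).filter fun d => (n + d).Prime) = windowCount n h := by
  unfold windowCount
  rw [← card_image_of_injective ((Icc 1 h).filter fun d => (n + d).Prime) (add_right_injective n)]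
  congr 1
  ext q
  simp only [mem_image, mem_filter, mem_Icc, mem_Ioc]
  constructor
  · rintro ⟨d, ⟨⟨hd1, hdh⟩, hp⟩, rfl⟩
    exact ⟨⟨by omega, by omega⟩, hp⟩
  · rintro ⟨⟨hnq, hqh⟩, hp⟩
    refine ⟨q - n, ⟨⟨by omega, by omega⟩, ?_⟩, by omega⟩
    rwa [show n + (q - n) = q by omega]

/-- **Counting identity, pointwise:** the falling factorial `(π(n+h) − π(n))^{(r)}` is the number of
ordered `r`-tuples of distinct shifts `1 ≤ d₁, …, d_r ≤ h` with all `n + dᵢ` prime (the inner sum of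
Gallagher's §1 display `∑_{n ≤ N} (π(n+h) − π(n))^k = ∑_r σ(k,r) ∑_d π_d(N)`, in its
factorial-moment form). [cite: Gallagher1976, Section 1 p. 5] -/
theorem descFactorial_windowCount (n h r : ℕ) :
    (windowCount n h).descFactorial r = #((distinctTuples r h).filter fun t => ∀ j, (n + t j).Prime) := by
  classical
  rw [← card_filter_shift_prime, ← card_filter_piFinset_injective]
  congr 1
  ext t
  simp only [distinctTuples, mem_filter, Fintype.mem_piFinset]
  constructor
  · rintro ⟨h1, h2⟩
    exact ⟨⟨fun a => (h1 a).1, h2⟩, fun j => (h1 j).2⟩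
  · rintro ⟨⟨h1, h2⟩, h3⟩
    exact ⟨fun a => ⟨h1 a, h3 a⟩, h2⟩

/-- **Counting identity, summed** [Gallagher §1]: `∑_{n ≤ N} (π(n+h) − π(n))^{(r)} = ∑_t π_t(N)`, the
sum over ordered distinct `r`-tuples `t` in `[1, h]^r`. [cite: Gallagher1976, Section 1 p. 5] -/
theorem sum_descFactorial_windowCount (h r N : ℕ) :
    ∑ n ∈ Icc 1 N, ((windowCount n h).descFactorial r : ℝ) =
      ∑ t ∈ distinctTuples r h, (orderedTupleCount t N : ℝ) := by
  classical
  simp_rw [descFactorial_windowCount, orderedTupleCount]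
  simp_rw [← sum_boole]
  exact sum_comm

/-! ### §3 Theorem 1 -/

/-- **Gallagher 1976, Theorem 1, from the averaged tuple counts.**  Let `h = h(N)` and `λ ∈ ℝ`.  If for
every `r` the averaged ordered-tuple count `N⁻¹ ∑_{t} π_t(N)` (`t` over distinct `r`-tuples in
`[1, h(N)]^r`) tends to `λʳ`, then for every `k`, `P_k(h(N), N)/N → e^{−λ} λᵏ / k!`.
(This is Theorem 1 with its analytic input — (1) averaged with (3) — as the hypothesis; §1 replaces
Gallagher's §3.) [cite: Gallagher1976, Theorem 1] -/
theorem Gallagher1976_theorem1_of_moments {lam : ℝ} {h : ℕ → ℕ}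
    (hmom : ∀ r : ℕ, Tendsto (fun N : ℕ =>
      (∑ t ∈ distinctTuples r (h N), (orderedTupleCount t N : ℝ)) / N) atTop (𝓝 (lam ^ r)))
    (k : ℕ) :
    Tendsto (fun N : ℕ => (exactCount k (h N) N : ℝ) / N) atTop
      (𝓝 (Real.exp (-lam) * lam ^ k / k.factorial)) := by
  have hmom' : ∀ r : ℕ, Tendsto (fun N : ℕ =>
      (∑ n ∈ Icc 1 N, ((windowCount n (h N)).descFactorial r : ℝ)) / N) atTop (𝓝 (lam ^ r)) := by
    intro r
    simp_rw [sum_descFactorial_windowCount]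
    exact hmom r
  exact tendsto_density_eq_of_factorialMoments hmom' k

/-- The empty tuple: `distinctTuples 0 h` is the singleton `{Fin.elim0}` and `π_∅(N) = N`, so the
`r = 0` moment is `N/N → 1` (the `k = 0` term of Gallagher's §1 display).
[cite: Gallagher1976, Section 1 p. 5] -/
theorem sum_orderedTupleCount_zero (h N : ℕ) :
    ∑ t ∈ distinctTuples 0 h, (orderedTupleCount t N : ℝ) = N := by
  classical
  have hset : distinctTuples 0 h = {Fin.elim0} := by
    ext t
    simp only [distinctTuples, mem_filter, Fintype.mem_piFinset, mem_singleton, IsEmpty.forall_iff,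
      true_and]
    exact ⟨fun _ => funext fun j => Fin.elim0 j, fun _ => Function.injective_of_subsingleton t⟩
  rw [hset, sum_singleton, orderedTupleCount]
  simp

/-- Gallagher's regime "`N → ∞, h ∼ λ log N`" forces `h → ∞` (so that (3), a limit in `h`, applies):
if `h(N)/log N → λ > 0` then `h(N) → ∞`. [cite: Gallagher1976, Theorem 1] -/
theorem tendsto_atTop_of_div_log {lam : ℝ} (hlam : 0 < lam) {h : ℕ → ℕ}
    (hh : Tendsto (fun N : ℕ => (h N : ℝ) / Real.log N) atTop (𝓝 lam)) :
    Tendsto h atTop atTop := by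
  have hlog : Tendsto (fun N : ℕ => Real.log N) atTop atTop :=
    Real.tendsto_log_atTop.comp tendsto_natCast_atTop_atTop
  have h1 : Tendsto (fun N : ℕ => (h N : ℝ) / Real.log N * Real.log N) atTop atTop :=
    hh.pos_mul_atTop hlam hlog
  have h2 : (fun N : ℕ => (h N : ℝ) / Real.log N * Real.log N) =ᶠ[atTop] fun N : ℕ => (h N : ℝ) := by
    filter_upwards [eventually_ge_atTop 2] with N hN
    have : Real.log N ≠ 0 := (Real.log_pos (by exact_mod_cast hN)).ne'
    field_simp
  exact tendsto_natCast_atTop_iff.1 (h1.congr' h2)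

/-- **Gallagher 1976, Theorem 1** (as printed, with the uniform tuple asymptotics in absolute-error
count form).  Let `λ > 0` and `h = h(N)` with `h(N)/log N → λ`.  Suppose that for each `r ≥ 1` and
`ε > 0`, for all large `N`, every ordered tuple `t` of distinct shifts in `[1, h(N)]` satisfies
`|π_t(N) − 𝔖(t) N / logʳ N| ≤ ε N / logʳ N` (Gallagher's "(1) holds, uniformly for
`1 ≤ d₁, …, d_r ≤ h`").  Then `P_k(h, N) ∼ N e^{−λ} λᵏ/k!` for every `k`.  The singular-series
average (3) is the tree theorem `Gallagher.tendsto_sum_singularSeries_div_pow`.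
[cite: Gallagher1976, Theorem 1] -/
theorem Gallagher1976_theorem1 {lam : ℝ} (hlam : 0 < lam) {h : ℕ → ℕ}
    (hh : Tendsto (fun N : ℕ => (h N : ℝ) / Real.log N) atTop (𝓝 lam))
    (hunif : ∀ r : ℕ, 1 ≤ r → ∀ ε : ℝ, 0 < ε → ∃ N₀ : ℕ, ∀ N : ℕ, N₀ ≤ N →
      ∀ t ∈ distinctTuples r (h N),
        |(orderedTupleCount t N : ℝ) - singularSeries (tupleSet t) * N / Real.log N ^ r| ≤
          ε * N / Real.log N ^ r)
    (k : ℕ) :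
    Tendsto (fun N : ℕ => (exactCount k (h N) N : ℝ) / N) atTop
      (𝓝 (Real.exp (-lam) * lam ^ k / k.factorial)) := by
  classical
  refine Gallagher1976_theorem1_of_moments (fun r => ?_) k
  rcases Nat.eq_zero_or_pos r with rfl | hr
  · -- `r = 0`
    simp_rw [sum_orderedTupleCount_zero, pow_zero]
    refine tendsto_const_nhds.congr' ?_
    filter_upwards [eventually_ge_atTop 1] with N hN
    have : (N : ℝ) ≠ 0 := by exact_mod_cast (by omega : N ≠ 0)
    field_simp
  -- `r ≥ 1`: main term `G(h) · (h/log N)^r` with `G(h) = h^{-r} ∑_t 𝔖(t) → 1`, error `≤ ε (h/log N)^r`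
  set G : ℕ → ℝ := fun hh => (∑ t ∈ distinctTuples r hh, singularSeries (tupleSet t)) / (hh : ℝ) ^ r
    with hG
  have hGlim : Tendsto G atTop (𝓝 1) := by
    have := tendsto_sum_singularSeries_div_pow r
    simp only [hG, distinctTuples]
    exact this
  have hhtop : Tendsto h atTop atTop := tendsto_atTop_of_div_log hlam hh
  have hratio : Tendsto (fun N : ℕ => ((h N : ℝ) / Real.log N) ^ r) atTop (𝓝 (lam ^ r)) := hh.pow r
  -- the main term
  have hmain : Tendsto (fun N : ℕ => G (h N) * ((h N : ℝ) / Real.log N) ^ r) atTop (𝓝 (lam ^ r)) := by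
    have := (hGlim.comp hhtop).mul hratio
    simpa using this
  have hmain_eq : ∀ᶠ N : ℕ in atTop, G (h N) * ((h N : ℝ) / Real.log N) ^ r =
      (∑ t ∈ distinctTuples r (h N), singularSeries (tupleSet t) * N / Real.log N ^ r) / N := by
    filter_upwards [eventually_ge_atTop 1, hhtop.eventually (eventually_ge_atTop 1)] with N hN hhN
    have hN' : (N : ℝ) ≠ 0 := by exact_mod_cast (by omega : N ≠ 0)
    have hhr : (h N : ℝ) ^ r ≠ 0 := pow_ne_zero _ (by exact_mod_cast (by omega : h N ≠ 0))
    have hR : (∑ t ∈ distinctTuples r (h N), singularSeries (tupleSet t) * N / Real.log N ^ r) / N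
        = (∑ t ∈ distinctTuples r (h N), singularSeries (tupleSet t)) / Real.log N ^ r := by
      rw [sum_div, sum_div]
      refine sum_congr rfl fun t _ => ?_
      rw [div_div, mul_div_mul_right _ _ hN']
    have hL : G (h N) * ((h N : ℝ) / Real.log N) ^ r
        = (∑ t ∈ distinctTuples r (h N), singularSeries (tupleSet t)) / Real.log N ^ r := by
      simp only [hG]
      rw [div_pow, div_mul_div_comm, mul_comm ((h N : ℝ) ^ r) (Real.log N ^ r),
        mul_div_mul_right _ _ hhr]
    rw [hL, hR]
  -- the error
  rw [Metric.tendsto_atTop]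
  intro ε hε
  -- choose `ε₁` with `ε₁ (λ^r + 1) ≤ ε/2`
  set ε₁ : ℝ := ε / (2 * (lam ^ r + 1)) with hε₁
  have hlr : 0 < lam ^ r + 1 := by positivity
  have hε₁pos : 0 < ε₁ := by positivity
  obtain ⟨N₀, hN₀⟩ := hunif r hr ε₁ hε₁pos
  have hmain' : Tendsto (fun N : ℕ =>
      (∑ t ∈ distinctTuples r (h N), singularSeries (tupleSet t) * N / Real.log N ^ r) / N) atTop
      (𝓝 (lam ^ r)) := hmain.congr' hmain_eq
  obtain ⟨N₁, hN₁⟩ := (Metric.tendsto_atTop.1 hmain') (ε / 2) (by positivity)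
  obtain ⟨N₂, hN₂⟩ := (Metric.tendsto_atTop.1 hratio) 1 one_pos
  refine ⟨max (max N₀ N₁) (max N₂ 1), fun N hN => ?_⟩
  have hN0 : N₀ ≤ N := le_trans (le_max_left _ _) ((le_max_left _ _).trans hN)
  have hN1 : N₁ ≤ N := le_trans (le_max_right _ _) ((le_max_left _ _).trans hN)
  have hN2 : N₂ ≤ N := le_trans (le_max_left _ _) ((le_max_right _ _).trans hN)
  have hNone : 1 ≤ N := le_trans (le_max_right _ _) ((le_max_right _ _).trans hN)
  have hNpos : (0 : ℝ) < N := by exact_mod_cast hNone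
  have hratioN : ((h N : ℝ) / Real.log N) ^ r ≤ lam ^ r + 1 := by
    have := hN₂ N hN2
    rw [Real.dist_eq, abs_lt] at this
    linarith
  -- bound the error sum
  have herr : |(∑ t ∈ distinctTuples r (h N), (orderedTupleCount t N : ℝ)) / N -
      (∑ t ∈ distinctTuples r (h N), singularSeries (tupleSet t) * N / Real.log N ^ r) / N| ≤
      ε₁ * ((h N : ℝ) / Real.log N) ^ r := by
    rw [← sub_div, ← sum_sub_distrib, abs_div, abs_of_pos hNpos, div_le_iff₀ hNpos]
    calc |∑ t ∈ distinctTuples r (h N),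
          ((orderedTupleCount t N : ℝ) - singularSeries (tupleSet t) * N / Real.log N ^ r)|
        ≤ ∑ t ∈ distinctTuples r (h N),
          |(orderedTupleCount t N : ℝ) - singularSeries (tupleSet t) * N / Real.log N ^ r| :=
          abs_sum_le_sum_abs _ _
      _ ≤ ∑ _t ∈ distinctTuples r (h N), ε₁ * N / Real.log N ^ r :=
          sum_le_sum fun t ht => hN₀ N hN0 t ht
      _ = #(distinctTuples r (h N)) * (ε₁ * N / Real.log N ^ r) := by rw [sum_const, nsmul_eq_mul]
      _ ≤ (h N : ℝ) ^ r * (ε₁ * N / Real.log N ^ r) := by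
          have hc : (#(distinctTuples r (h N)) : ℝ) ≤ (h N : ℝ) ^ r := by
            exact_mod_cast card_distinctTuples_le r (h N)
          have hnn : 0 ≤ ε₁ * N / Real.log N ^ r := by
            apply div_nonneg (by positivity)
            exact pow_nonneg (Real.log_natCast_nonneg N) r
          exact mul_le_mul_of_nonneg_right hc hnn
      _ = ε₁ * ((h N : ℝ) / Real.log N) ^ r * N := by rw [div_pow]; ring
  have hm := hN₁ N hN1
  rw [Real.dist_eq] at hm ⊢
  have hε₁b : ε₁ * ((h N : ℝ) / Real.log N) ^ r ≤ ε / 2 := by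
    calc ε₁ * ((h N : ℝ) / Real.log N) ^ r ≤ ε₁ * (lam ^ r + 1) :=
          mul_le_mul_of_nonneg_left hratioN hε₁pos.le
      _ = ε / 2 := by rw [hε₁]; field_simp
  calc |(∑ t ∈ distinctTuples r (h N), (orderedTupleCount t N : ℝ)) / N - lam ^ r|
      ≤ |(∑ t ∈ distinctTuples r (h N), (orderedTupleCount t N : ℝ)) / N -
          (∑ t ∈ distinctTuples r (h N), singularSeries (tupleSet t) * N / Real.log N ^ r) / N| +
        |(∑ t ∈ distinctTuples r (h N), singularSeries (tupleSet t) * N / Real.log N ^ r) / N -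
          lam ^ r| := abs_sub_le _ _ _
    _ < ε / 2 + ε / 2 := add_lt_add_of_le_of_lt (herr.trans hε₁b) hm
    _ = ε := by ring

end Literature.NumberTheory.Sieve.Gallagher
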